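import Summits.ResolutionOfSingularities.ResolutionOfSingularities.Theorems.EquisingularLiftEquisingularLiftNatTowerCechCentre
import Summits.ResolutionOfSingularities.ResolutionOfSingularities.Theorems.EquisingularLiftEquisingularLiftNatSectionRootTransport
import Summits.ResolutionOfSingularities.ResolutionOfSingularities.Theorems.EquisingularLiftEquisingularLiftNatSpecialFibreFrames
import Summits.ResolutionOfSingularities.ResolutionOfSingularities.Theorems.EquisingularLiftEquisingularLiftNatDirDictSection
import Summits.ResolutionOfSingularities.ResolutionOfSingularities.Theorems.EquisingularLiftEquisingularLiftNatDirectionCentreSection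
import Summits.ResolutionOfSingularities.ResolutionOfSingularities.Theorems.EquisingularLiftEquisingularLiftNatDirectionCentreComap
import Summits.ResolutionOfSingularities.ResolutionOfSingularities.Theorems.EquisingularLiftEquisingularLiftNatDirectionCentreCartier
import Literature.AlgebraicGeometry.Resolution.BlowupsProperProofs
import Literature.AlgebraicGeometry.Resolution.MarkedIdealsLemmas
import HarnessLib

/-!
# [OURS · L1 W4.5(b) · EL♮(3)] HSUB′(ReachTower₃) — S6 (a)–(c)→(N1°): THE ČECH CENTRE AT THE ROOT FROM THE LIFTED DIRECTION
# (the root-level stand-in (N1°) `hRootCentre` of …NatTowerCechCentre REDUCED to the direction-lift stand-in (L) `hLift` = T-DIRLIFT-UP's conclusion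
# block (res-D-pv-051, sig 9b7825e935ffb8f7 / v2) fed with the pushed section; over res-L1-w45b-stub-2's …NatSectionRootTransport (p570399),
# …NatSpecialFibreFrames, …NatDirectionCentreCartier, res-D-pv-051's DIRDICT (a) p559974 and T-DIRLIFT D3b p555056 / D4 p551347)

res-D-pv-057 g9 AS a w45b hand (S6 `hCech`; stub-2's decomposition note 20:25:39Z (a)–(d); INTERFACE FINDING 20:58:54Z + res-D-pv-051 WORD 21:06:46Z:
`hreg` idle — not passed; `hunobs` handed over in STAGE form with the special-fibre isomorphisms `ε`, `εZ` (v3 «exceptional pair abstracted»), so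
no `normalSheaf` transport is attempted here). OURS; NOT a statement of any manuscript; AI-written, weaker than expert review. No `sorry`; standard axioms.
DEF-FREE. `--supports stmt-ResolutionOfSingularities-20148 --as helper`. Pattern (E).

WHAT. `Tower.hRootCentre_of_lift`: the (N1°) text of `Tower.hCentre_of_root` FOLLOWS from the stand-in **(L) `hLift`** — «at the root `(X₀ ⊇ V(I), j₀ : G₀ → X₀)`
of `DirLift.Ruled`, for the section `Γ₁ := ϱ″Z ⊆ E₁ = υ₁⁻¹Z₀` (closed, `δ₁ : Γ̃₁ ≅ Z̃₀` over `υ₁`, `Ẽ₁` regular along it, the stage's `DirStepUnobs` handed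
with `ε : Ẽ ≅ Ẽ₁`, `εZ : Z̃ ≅ Γ̃₁`) and the downstairs direction `𝒟̄` of `Γ₁` (DIRDICT (a), output block verbatim), there is an upstairs direction `𝒟` with
`I·I ≤ 𝒟 ≤ I`, quasi-regular frames `(c₀, c₁)` of `I` with `𝒟_x = (c₀) + (c₁²)` at EVERY point of `V(I)`, and `𝒟·𝒪_{G₀} = 𝒟̄`» (= T-DIRLIFT-UP v2's conclusion
with frames ∀ x ∈ supp I; its proof is route C, res-D-pv-051 / res-type-027 / stub-2's C3). GIVEN (L): `C₁ := controlledTransform τ₀ I 𝒟 1` has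
`I·𝒪 ≤ C₁` (`le_colon_iff`), `V(C₁) ≅ V(I)` over `τ₀` (D3b) hence regular and `O`-flat, `C₁|_{V(I·𝒪)}` effective Cartier (stub-2 p57xxxx
`isEffectiveCartier_directionCentre_comap_exceptional`), trace `C₁·𝒪_{G₁} = 𝓘⟨Γ₁⟩` (D4 + `hctr`), `E ∩ ϱ⁻¹Γ₁ = Z` (stub-2 `inter_preimage_image_eq_of_redSub_iso_over`),
and `V(C₁) ≅ ℙ¹_O` when the carrier is certified rational (res-L1-type-o6 `RatCarrier.hCrat_directionCentre`).
-/

set_option linter.dupNamespace false -- mandated namespace `Summit.<Summit>.<Problem>` of this single-conjunct summit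
set_option linter.overlappingInstances false -- signatures carry `[IsDomain O] [IsDiscreteValuationRing O]`

noncomputable section

open CategoryTheory CategoryTheory.Limits AlgebraicGeometry TopologicalSpace Topology IsLocalRing
open Literature.AlgebraicGeometry.Resolution
open Literature.AlgebraicGeometry.Morphisms (ProjCech.PP ProjCech.toSpec)
open AlgebraicGeometry.Scheme.IdealSheafData
open Summit.ResolutionOfSingularities.ResolutionOfSingularities.Theses.EquisingularLift.Split
open Summit.ResolutionOfSingularities.ResolutionOfSingularities.Cruxes.EquisingularLift.StrataSplit

namespace Summit.ResolutionOfSingularities.ResolutionOfSingularities.Cruxes.EquisingularLiftNat.Sections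

set_option maxHeartbeats 1600000 in -- long binder texts
/-- **(N1°) from (L)**: the root-level Čech centre of `Tower.hCentre_of_root` from the lifted direction (see the module docstring).
[cite: GortzWedhorn2020, Prop. 4.20, (13.19) and Prop. 13.91] [cite: StacksProject, Tags 0804, 0805] [OURS · L1 W4.5b · S6 (a)–(c)] toward
`stub_elnat_coneTowerPointResolution` (stmt-ResolutionOfSingularities-20148 / -20038); NOT a statement of the manuscript. -/
theorem Tower.hRootCentre_of_lift (O : Type) [CommRing O] [IsDomain O] [IsDiscreteValuationRing O] (k : Type) [Field k]
    (θ : O →+* k) (hθ : Function.Surjective θ) (P : Scheme.{0}) (q : P ⟶ Spec (.of O)) (Y : Set P)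
    -- (L) STAND-IN: the direction lift at the root (T-DIRLIFT-UP, res-D-pv-051; frames at every point of `V(I)` = v2)
    (hLift : ∀ {F₉ : Scheme.{0}} (Z₉ : Set F₉) (hZ₉ : IsClosed Z₉)
        (G : Scheme.{0}) (E : Set G) (hE : IsClosed E) (Z : Set G) (hZ : IsClosed Z)
        (X₀ : Scheme.{0}) (σ₀ : X₀ ⟶ P) (I : X₀.IdealSheafData) (G₀ : Scheme.{0}) (j₀ : G₀ ⟶ X₀) (t₀ : G₀ ⟶ Spec (.of k))
        (Z₀ : Set G₀) (hZ₀ : IsClosed Z₀) (G₁ : Scheme.{0}) (υ₁ : G₁ ⟶ G₀) (ϱ : G ⟶ G₁)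
        (E₁ : Set G₁) (hE₁ : IsClosed E₁) (Γ₁ : Set G₁) (hΓ₁ : IsClosed Γ₁)
        (ε : redSub G E hE ⟶ redSub G₁ E₁ hE₁) (εZ : redSub G Z hZ ⟶ redSub G₁ Γ₁ hΓ₁) (𝒟' : G₀.IdealSheafData),
        -- the root (R1)–(R4)
        IsIntegral X₀ → IsLocallyNoetherian X₀ → Scheme.IsRegular X₀ →
        IsPullback j₀ t₀ (σ₀ ≫ q) (Spec.map (CommRingCat.ofHom θ)) →
        Scheme.IsRegular I.subscheme → Flat (I.subschemeι ≫ σ₀ ≫ q) →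
        (∀ x ∈ I.support, ∃ c : Fin 2 → X₀.presheaf.stalk x, Ideal.span (Set.range c) = stalkIdeal I x ∧ IsQuasiRegular c) →
        RationalCarrier (redSub F₉ Z₉ hZ₉) →
        (RationalCarrier (redSub F₉ Z₉ hZ₉) → ∃ e₁ : I.subscheme ≅ ProjCech.PP O 1, e₁.hom ≫ ProjCech.toSpec O 1 = I.subschemeι ≫ σ₀ ≫ q) →
        I.comap j₀ = vanishingIdeal ⟨Z₀, hZ₀⟩ →
        -- the downstairs round at the root: blow-up of the carrier trace, the pushed section `Γ₁ ⊆ E₁ = υ₁⁻¹Z₀`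
        IsBlowup υ₁ (vanishingIdeal (⟨Z₀, hZ₀⟩ : Closeds G₀)) → E₁ = υ₁ ⁻¹' Z₀ → Γ₁ ⊆ E₁ → Γ₁ = ϱ '' Z → Z ⊆ E →
        (∃ δ₁ : redSub G₁ Γ₁ hΓ₁ ⟶ redSub G₀ Z₀ hZ₀, δ₁ ≫ redSubι G₀ Z₀ hZ₀ = redSubι G₁ Γ₁ hΓ₁ ≫ υ₁ ∧ IsIso δ₁) →
        (∀ (i₁ : redSub G₁ Γ₁ hΓ₁ ⟶ redSub G₁ E₁ hE₁), i₁ ≫ redSubι G₁ E₁ hE₁ = redSubι G₁ Γ₁ hΓ₁ →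
          ∀ x₁ : redSub G₁ Γ₁ hΓ₁, IsRegularLocalRing ((redSub G₁ E₁ hE₁).presheaf.stalk (i₁ x₁))) →
        -- the stage's unobstructedness datum, handed with the special-fibre isomorphisms (exceptional pair abstracted)
        IsIso ε → ε ≫ redSubι G₁ E₁ hE₁ = redSubι G E hE ≫ ϱ → IsIso εZ → εZ ≫ redSubι G₁ Γ₁ hΓ₁ = redSubι G Z hZ ≫ ϱ →
        (∀ x : redSub G Z hZ, IsRegularLocalRing (G.presheaf.stalk (redSubι G Z hZ x))) → DirStepUnobs G E hE Z hZ →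
        -- the downstairs direction of `Γ₁` (DIRDICT (a) `exists_direction_of_section`, output block verbatim)
        vanishingIdeal (⟨Z₀, hZ₀⟩ : Closeds G₀) * vanishingIdeal (⟨Z₀, hZ₀⟩ : Closeds G₀) ≤ 𝒟' → 𝒟' ≤ vanishingIdeal (⟨Z₀, hZ₀⟩ : Closeds G₀) →
        (∀ z ∈ Z₀, ∃ c : Fin 2 → G₀.presheaf.stalk z,
          Ideal.span (Set.range c) = stalkIdeal (vanishingIdeal (⟨Z₀, hZ₀⟩ : Closeds G₀)) z ∧ IsQuasiRegular c ∧
          stalkIdeal 𝒟' z = Ideal.span {c 0} ⊔ Ideal.span {c 1 * c 1}) →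
        controlledTransform υ₁ (vanishingIdeal (⟨Z₀, hZ₀⟩ : Closeds G₀)) 𝒟' 1 = vanishingIdeal (⟨Γ₁, hΓ₁⟩ : Closeds G₁) →
        ∃ 𝒟 : X₀.IdealSheafData, I * I ≤ 𝒟 ∧ 𝒟 ≤ I ∧
          (∀ x ∈ I.support, ∃ c : Fin 2 → X₀.presheaf.stalk x, Ideal.span (Set.range c) = stalkIdeal I x ∧ IsQuasiRegular c ∧
            stalkIdeal 𝒟 x = Ideal.span {c 0} ⊔ Ideal.span {c 1 * c 1}) ∧
          𝒟.comap j₀ = 𝒟') :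
    -- ======== the (N1°) text of `Tower.hCentre_of_root`, VERBATIM ========
    ∀ {F₉ : Scheme.{0}} (Z₉ : Set F₉) (hZ₉ : IsClosed Z₉) {F₁₀ : Scheme.{0}} (υ' : F₁₀ ⟶ F₉)
        (G : Scheme.{0}) (γ : G ⟶ F₁₀) (E : Set G) (hE : IsClosed E) (Z : Set G) (hZ : IsClosed Z),
        DirStepSec F₉ F₁₀ υ' Z₉ hZ₉ G γ Z hZ → RationalCarrier (redSub F₉ Z₉ hZ₉) →
        (∀ x : redSub G Z hZ, IsRegularLocalRing (G.presheaf.stalk (redSubι G Z hZ x))) →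
        (∀ (i : redSub G Z hZ ⟶ redSub G E hE), i ≫ redSubι G E hE = redSubι G Z hZ →
          ∀ x : redSub G Z hZ, IsRegularLocalRing ((redSub G E hE).presheaf.stalk (i x))) →
        DirStepUnobs G E hE Z hZ → Z ⊆ E →
        ∀ (X : Scheme.{0}) (σ : X ⟶ P) (jG : G ⟶ X) (tG : G ⟶ Spec (.of k)) (𝓔 : X.IdealSheafData),
        IsIntegral X → IsLocallyNoetherian X → Scheme.IsRegular X →
        IsPullback jG tG (σ ≫ q) (Spec.map (CommRingCat.ofHom θ)) →
        𝓔.comap jG = vanishingIdeal ⟨E, hE⟩ → (∀ z : X, (stalkIdeal 𝓔 z).IsPrincipal) → Scheme.IsRegular 𝓔.subscheme →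
        ∀ (X₀ : Scheme.{0}) (σ₀ : X₀ ⟶ P) (I : X₀.IdealSheafData) (X₁ : Scheme.{0}) (τ₀ : X₁ ⟶ X₀) (ρ : X ⟶ X₁)
          (G₀ : Scheme.{0}) (j₀ : G₀ ⟶ X₀) (t₀ : G₀ ⟶ Spec (.of k)) (γ₀ : G₀ ⟶ F₉)
          (G₁ : Scheme.{0}) (j₁ : G₁ ⟶ X₁) (t₁ : G₁ ⟶ Spec (.of k)) (υ₁ : G₁ ⟶ G₀) (ϱ : G ⟶ G₁)
          (e : 𝓔.subscheme ≅ (I.comap τ₀).subscheme) (Z₀ : Set G₀) (hZ₀ : IsClosed Z₀) (δ₀ : redSub G₀ Z₀ hZ₀ ⟶ redSub F₉ Z₉ hZ₉),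
        IsIntegral X₀ → IsLocallyNoetherian X₀ → Scheme.IsRegular X₀ → IsBlowup τ₀ I → σ = (ρ ≫ τ₀) ≫ σ₀ →
        e.hom ≫ (I.comap τ₀).subschemeι = 𝓔.subschemeι ≫ ρ →
        IsPullback j₀ t₀ (σ₀ ≫ q) (Spec.map (CommRingCat.ofHom θ)) → IsPullback j₁ t₁ ((τ₀ ≫ σ₀) ≫ q) (Spec.map (CommRingCat.ofHom θ)) →
        j₁ ≫ τ₀ = υ₁ ≫ j₀ → IsBlowup υ₁ (I.comap j₀) → jG ≫ ρ = ϱ ≫ j₁ → ϱ ≫ υ₁ ≫ γ₀ = γ ≫ υ' →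
        I.comap j₀ = vanishingIdeal ⟨Z₀, hZ₀⟩ → δ₀ ≫ redSubι F₉ Z₉ hZ₉ = redSubι G₀ Z₀ hZ₀ ≫ γ₀ → IsIso δ₀ →
        Scheme.IsRegular I.subscheme → Flat (I.subschemeι ≫ σ₀ ≫ q) → σ₀ '' (I.support : Set X₀) ⊆ {p : P | ¬ IsGenericPoint p Y} →
        (∀ x ∈ I.support, ∃ c : Fin 2 → X₀.presheaf.stalk x, Ideal.span (Set.range c) = stalkIdeal I x ∧ IsQuasiRegular c) →
        (RationalCarrier (redSub F₉ Z₉ hZ₉) → ∃ e₁ : I.subscheme ≅ ProjCech.PP O 1, e₁.hom ≫ ProjCech.toSpec O 1 = I.subschemeι ≫ σ₀ ≫ q) →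
        ∃ (C₁ : X₁.IdealSheafData) (Γ₁ : Set G₁) (hΓ₁ : IsClosed Γ₁),
          I.comap τ₀ ≤ C₁ ∧ Scheme.IsRegular C₁.subscheme ∧ Flat (C₁.subschemeι ≫ (τ₀ ≫ σ₀) ≫ q) ∧
          IsEffectiveCartier (C₁.comap (I.comap τ₀).subschemeι) ∧
          C₁.comap j₁ = vanishingIdeal ⟨Γ₁, hΓ₁⟩ ∧ E ∩ ϱ ⁻¹' Γ₁ = Z ∧
          (RationalCarrier (redSub F₉ Z₉ hZ₉) →
            ∃ e₁ : C₁.subscheme ≅ ProjCech.PP O 1, e₁.hom ≫ ProjCech.toSpec O 1 = C₁.subschemeι ≫ (τ₀ ≫ σ₀) ≫ q) := by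
  intro F₉ Z₉ hZ₉ F₁₀ υ' G γ E hE Z hZ hsec hrat hGreg hEreg hunobs hZE X σ jG tG 𝓔 hXint hXnoeth hXreg hsq he_i _ _
    X₀ σ₀ I X₁ τ₀ ρ G₀ j₀ t₀ γ₀ G₁ j₁ t₁ υ₁ ϱ e Z₀ hZ₀ δ₀ hX₀int hX₀noeth hX₀reg hτ₀ hσ he hsq₀ hsq₁ hcomm₁ hυ₁ hjρ hγ hIZ₀ hδ₀ hδ₀iso
    hIreg hIflat _ hIframe hIrat
  haveI := hXint
  haveI := hXnoeth
  haveI := hX₀int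
  haveI := hX₀noeth
  haveI : IsLocallyNoetherian X₁ := hτ₀.isLocallyNoetherian
  haveI : UniversallyClosed τ₀ := by haveI := hτ₀.isProper; infer_instance
  -- the root's special fibre is locally Noetherian (closed subscheme of `X₀`), so its blow-up `υ₁` is universally closed
  haveI : IsClosedImmersion (Spec.map (CommRingCat.ofHom θ)) := IsClosedImmersion.spec_of_surjective _ hθ
  haveI : IsClosedImmersion j₀ := MorphismProperty.IsStableUnderBaseChange.of_isPullback hsq₀.flip inferInstance
  haveI : IsLocallyNoetherian G₀ := LocallyOfFiniteType.isLocallyNoetherian j₀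
  have hυ₁' : IsBlowup υ₁ (vanishingIdeal (⟨Z₀, hZ₀⟩ : Closeds G₀)) := by rw [← hIZ₀]; exact hυ₁
  haveI : UniversallyClosed υ₁ := by haveI := hυ₁'.isProper; infer_instance
  -- the exceptional divisor of the root and its reduced trace `E₁ = υ₁⁻¹Z₀`
  have hsupp : (((I.comap τ₀).comap j₁).support : Set G₁) = υ₁ ⁻¹' Z₀ := coe_support_comap_comap_eq_preimage τ₀ j₀ j₁ υ₁ hcomm₁ I hZ₀ hIZ₀
  have hE₁ : IsClosed (υ₁ ⁻¹' Z₀) := hZ₀.preimage υ₁.continuous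
  -- the cartesian square of special fibres `(jG, ϱ, ρ, j₁)` and the isomorphism `ε : Ẽ ≅ Ẽ₁`
  have hsq' : IsPullback jG tG (ρ ≫ (τ₀ ≫ σ₀) ≫ q) (Spec.map (CommRingCat.ofHom θ)) := by
    have h := hsq
    rw [hσ] at h
    simpa only [Category.assoc] using h
  have hcart : IsPullback jG ϱ ρ j₁ := isPullback_of_model_squares θ hθ ((τ₀ ≫ σ₀) ≫ q) ρ j₁ t₁ hsq₁ jG tG hsq' ϱ hjρ
  obtain ⟨hE₁tr, ε, hε, hεiso⟩ :=
    comap_eq_vanishingIdeal_and_exists_isIso_redSub_of_iso_over ρ jG j₁ ϱ hcart 𝓔 (I.comap τ₀) e he hE he_i hE₁ hsupp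
  haveI := hεiso
  -- the pushed section `Γ₁ := ϱ″Z`
  obtain ⟨hc, εZ, hεZ, hεZiso⟩ := exists_isIso_redSub_image ϱ hE hE₁ ε hε hZ hZE
  haveI := hεZiso
  have hΓE₁ : ϱ '' Z ⊆ υ₁ ⁻¹' Z₀ := (Set.image_mono hZE).trans (image_subset_of_redSub_hom_over ϱ hE hE₁ ε hε)
  obtain ⟨δ₁, hδ₁, hδ₁iso⟩ := exists_dirStepSec_root_image υ' Z₉ hZ₉ γ hZ hsec γ₀ hZ₀ ⟨δ₀, hδ₀, hδ₀iso⟩ υ₁ ϱ hγ hE hZE hE₁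
    subset_rfl ε hε hc
  have hEreg₁ := forall_isRegularLocalRing_stalk_of_redSub_isos ϱ hE hZ hZE hE₁ hc ε hε εZ hεZ hEreg
  -- quasi-regular 2-frames of the reduced carrier trace `𝓘⟨Z₀⟩` (stub-2's …NatSpecialFibreFrames)
  have hfr := forall_exists_twoFrame_specialFibre_of_flat O k θ hθ (σ₀ ≫ q) j₀ t₀ hsq₀ I hIflat hIframe hZ₀ hIZ₀
  -- DIRDICT (a): the downstairs direction of the section `Γ₁`
  obtain ⟨𝒟', hII, h𝒟'I, hdir', hctr⟩ := exists_direction_of_section (υ := υ₁) Z₀ hZ₀ hυ₁' hfr (ϱ '' Z) hc hΓE₁ ⟨δ₁, hδ₁, hδ₁iso⟩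
  -- (L) the lift
  obtain ⟨𝒟, hI𝒟, _, hdir, h𝒟tr⟩ := hLift Z₉ hZ₉ G E hE Z hZ X₀ σ₀ I G₀ j₀ t₀ Z₀ hZ₀ G₁ υ₁ ϱ (υ₁ ⁻¹' Z₀) hE₁ (ϱ '' Z) hc ε εZ 𝒟'
    hX₀int hX₀noeth hX₀reg hsq₀ hIreg hIflat hIframe hrat hIrat hIZ₀ hυ₁' rfl hΓE₁ rfl hZE ⟨δ₁, hδ₁, hδ₁iso⟩ hEreg₁ hεiso hε hεZiso hεZ
    hGreg hunobs hII h𝒟'I hdir' hctr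
  -- the centre `C₁ := controlledTransform τ₀ I 𝒟 1`
  have hdir₀ : ∀ z ∈ (I.comap j₀).support, ∃ c : Fin 2 → X₀.presheaf.stalk (j₀ z),
      Ideal.span (Set.range c) = stalkIdeal I (j₀ z) ∧ stalkIdeal 𝒟 (j₀ z) = Ideal.span {c 0} ⊔ Ideal.span {c 1 * c 1} := by
    intro z hz
    have hx : j₀ z ∈ I.support := by
      have h : z ∈ ((I.comap j₀).support : Set G₀) := hz
      rw [Scheme.IdealSheafData.support_comap] at h
      exact h
    obtain ⟨c, hc1, -, h𝒟⟩ := hdir _ hx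
    exact ⟨c, hc1, h𝒟⟩
  obtain ⟨e₁, he₁⟩ := exists_subschemeIso_directionCentre hτ₀ 𝒟 hI𝒟 hdir
  refine ⟨controlledTransform τ₀ I 𝒟 1, ϱ '' Z, hc, ?_, ?_, ?_, ?_, ?_, ?_, ?_⟩
  · -- `I·𝒪_{X₁} ≤ C₁`: `(I·𝒪)·(I·𝒪) = (I·I)·𝒪 ≤ 𝒟·𝒪`
    change I.comap τ₀ ≤ colon (𝒟.comap τ₀) ((I.comap τ₀) ^ 1)
    rw [le_colon_iff, pow_one, ← comap_mul]
    exact Scheme.IdealSheafData.comap_mono τ₀ hI𝒟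
  · -- regular, along `V(C₁) ≅ V(I)`
    intro a
    haveI := hIreg (e₁.hom a)
    exact IsRegularLocalRing.of_ringEquiv (asIso (e₁.hom.stalkMap a)).commRingCatIsoToRingEquiv
  · -- flat over `O`, along `V(C₁) ≅ V(I)`
    have h : (controlledTransform τ₀ I 𝒟 1).subschemeι ≫ (τ₀ ≫ σ₀) ≫ q = e₁.hom ≫ (I.subschemeι ≫ σ₀ ≫ q) := by
      rw [← Category.assoc e₁.hom, he₁]; simp only [Category.assoc]
    rw [h]
    infer_instance
  · -- `C₁` is a Cartier divisor on the exceptional divisor (stub-2's …NatDirectionCentreCartier)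
    exact isEffectiveCartier_directionCentre_comap_exceptional hτ₀ 𝒟 hdir
  · -- the trace `C₁·𝒪_{G₁} = 𝓘⟨Γ₁⟩` (D4 + DIRDICT (a)'s `hctr`)
    rw [comap_directionCentre_eq_of_model hτ₀ 𝒟 hI𝒟 hcomm₁ hυ₁ hdir₀, hIZ₀, h𝒟tr, hctr]
  · -- the pushed section: `E ∩ ϱ⁻¹(ϱ″Z) = Z`
    exact inter_preimage_image_eq_of_redSub_iso_over ϱ hE hE₁ ε hε hZE
  · -- rational, along `V(C₁) ≅ V(I) ≅ ℙ¹_O`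
    exact RatCarrier.hCrat_reassoc σ₀ q τ₀ (controlledTransform τ₀ I 𝒟 1)
      (RatCarrier.hCrat_directionCentre (σ₀ ≫ q) τ₀ I hτ₀ 𝒟 hI𝒟 hdir hIrat)

end Summit.ResolutionOfSingularities.ResolutionOfSingularities.Cruxes.EquisingularLiftNat.Sections

end
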